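import Summits.MatrixMultiplication.MatrixMultiplication.Theorems.CharacteristicContinuityTransfer
import Summits.MatrixMultiplication.MatrixMultiplication.Theorems.CharacteristicContinuityFixedFormat
import HarnessLib

/-!
# CharacteristicContinuityUniformWitness — the residual `K` in witness form
(decomp-mm cell, lens 5 «finite/base range + asymptotic regime + bridge», generation 9; part 2 of 2)

* `uniformWitnessIff_holds : UniformWitnessIff` — item `stmt-MatrixMultiplication-18043` of the dormant
  route `route-MatrixMultiplication-CharacteristicContinuity`: lower semicontinuity of `ω` at
  characteristic zero (`ContinuityAtZero`, the route's declared residual K) is EQUIVALENT to UNIFORM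
  WITNESS SIZES across large characteristics,
  `∀ ε ∃ N p₀ ∀ p ≥ p₀ ∃ 2 ≤ n ≤ N, R_{𝔽̄_p}(⟨n,n,n⟩) ≤ n^{ω(𝔽̄_p)+ε}`:
  `→` by reducing one near-optimal rational scheme modulo `p` (landed
  `CharacteristicContinuityTransfer.exists_format_eventually`), `←` by fixed-format continuity
  (`CharacteristicContinuityFixedFormat.fixedFormatContinuity_holds`, Lefschetz) at the finitely many
  formats `n ≤ N` and `ω(ℂ) ≤ log_n R_ℂ(⟨n,n,n⟩)`.  Lens reading: this is exactly how far the finite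
  range (witness format `N`) must reach, UNIFORMLY in `p`, for the fixed-format bridge to bite on `ω`.
* `assembly_holds : Assembly` — item `stmt-MatrixMultiplication-18046` (the route's deciding theorem
  `closes`, read as the item).

References: [cite: BurgisserClausenShokrollahi1997, Cor. (15.18) and p. 410]; [cite: Blaser2013, Def. 5.1].
-/

set_option linter.dupNamespace false -- `MatrixMultiplication.MatrixMultiplication` (summit = problem, D-0017)

noncomputable section

open Filter Finset
open Literature.Computability.AlgebraicComplexity
open Summit.MatrixMultiplication.MatrixMultiplication.Theses.CharacteristicContinuity
open Summit.MatrixMultiplication.MatrixMultiplication.Theorems.CharacteristicContinuityTransfer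
open Summit.MatrixMultiplication.MatrixMultiplication.Theorems.CharacteristicContinuityFixedFormat

namespace Summit.MatrixMultiplication.MatrixMultiplication.Theorems.CharacteristicContinuityUniformWitness

/-! ## Item 18043: the residual `K` in witness form -/

/-- **Item `stmt-MatrixMultiplication-18043` (`UniformWitnessIff`)**: lower semicontinuity of `ω` at
characteristic zero (`ContinuityAtZero`) is equivalent to UNIFORM WITNESS SIZES across large
characteristics. [cite: BurgisserClausenShokrollahi1997, Cor. (15.18)] [cite: Blaser2013, Def. 5.1] -/
theorem uniformWitnessIff_holds : UniformWitnessIff := by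
  constructor
  · -- `K → uniform witnesses`: one near-optimal rational format, reduced modulo `p`.
    intro hK ε hε
    obtain ⟨p₀, hp₀⟩ := hK (ε / 2) (by positivity)
    obtain ⟨N, hN, p₁, hp₁⟩ := exists_format_eventually (γ := omega ℂ + ε / 2) (by linarith)
    refine ⟨N, max p₀ p₁, fun p inst hp => ⟨N, hN, le_rfl, ?_⟩⟩
    have h1 := hp₁ p ((le_max_right _ _).trans hp)
    have h2 := hp₀ p ((le_max_left _ _).trans hp)
    have hN1 : (1 : ℝ) ≤ N := by exact_mod_cast (le_trans one_le_two hN)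
    exact h1.trans (Real.rpow_le_rpow_of_exponent_le hN1 (by linarith))
  · -- `uniform witnesses → K`: fixed-format continuity at the finitely many formats `n ≤ N`.
    intro hU ε hε
    obtain ⟨N, p₀, hNp⟩ := hU ε hε
    have hff : ∀ j : Fin (N + 1), ∃ p₁ : ℕ, ∀ (p : ℕ) [Fact p.Prime], p₁ ≤ p →
        tensorRank (matMulTensor (AlgebraicClosure (ZMod p)) j j j) =
          tensorRank (matMulTensor ℂ j j j) :=
      fun j => fixedFormatContinuity_holds j j j
    choose P hP using hff
    refine ⟨max p₀ (Finset.univ.sup P), fun p inst hp => ?_⟩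
    obtain ⟨n, hn2, hnN, hrank⟩ := hNp p ((le_max_left _ _).trans hp)
    have hPn : P ⟨n, Nat.lt_succ_of_le hnN⟩ ≤ p :=
      (Finset.le_sup (f := P) (Finset.mem_univ _)).trans ((le_max_right _ _).trans hp)
    have heq : tensorRank (matMulTensor (AlgebraicClosure (ZMod p)) n n n) =
        tensorRank (matMulTensor ℂ n n n) := hP ⟨n, Nat.lt_succ_of_le hnN⟩ p hPn
    refine omega_le_of_tensorRank_le_rpow ℂ hn2 ?_
    rw [← heq]
    exact hrank

/-! ## Item 18046: the assembly -/

/-- **Item `stmt-MatrixMultiplication-18046` (`Assembly`)**: `LargeCharacteristicFast → ContinuityAtZero →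
MatrixMultiplication`, proved directly (W and K at `δ/2` along a prime above both thresholds; no longer via the route's
`closes`, which since rev 4 takes `EventualTransfer`). [cite: BurgisserClausenShokrollahi1997, Cor. (15.18)] -/
theorem assembly_holds : Assembly := fun hW hK => by
  -- closes-free proof (decoupled from the route's deciding theorem `closes`, whose binder became
  -- `EventualTransfer` at route rev 4, 2026-08-30T10:20:55Z): W at δ/2 and K at δ/2 along a large prime.
  show Literature.Computability.AlgebraicComplexity.omega ℂ = 2
  refine le_antisymm ?_ (Literature.Computability.AlgebraicComplexity.omega_two_le ℂ)
  refine le_of_forall_pos_le_add fun δ hδ => ?_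
  obtain ⟨p₁, h₁⟩ := hW (δ / 2) (by positivity)
  obtain ⟨p₂, h₂⟩ := hK (δ / 2) (by positivity)
  obtain ⟨p, hp, hprime⟩ := Nat.exists_infinite_primes (max p₁ p₂)
  haveI : Fact p.Prime := ⟨hprime⟩
  have a := h₁ p (le_trans (le_max_left _ _) hp)
  have b := h₂ p (le_trans (le_max_right _ _) hp)
  linarith

end Summit.MatrixMultiplication.MatrixMultiplication.Theorems.CharacteristicContinuityUniformWitness

end
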